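import Mathlib
import HarnessLib

/-!
# Large-scale certificate for the conformal kernel domination (stub `stub_certLarge`)

Helper for the line `conformal-kernel-domination` of the crux
`Summit.SmoothPoincare4.SmoothPoincare4.Theses.CylinderEntropy.SliceIsolation` (crux item
stmt-SmoothPoincare4-7632).  In the normalised variables `T = t/‖y‖² > 0`, `u = z₅ − log ‖y‖`,
`s = ⟨z', ŷ⟩ ∈ [−1, 1]` the Jacobian-weighted pulled-back Euclidean Gaussian kernel times `V = 8π²/3` is
`pulled(T,u,s) = (8π²/3)·((4πT)²)⁻¹·exp(4u)·exp(−(exp(2u) − 2·exp(u)·s + 1)/(4T))`.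
We prove the LARGE-SCALE certificate: for `T ≥ 4·10⁴` the constant ("area atom") `147/100` alone
dominates `pulled(T,·,·)` on `ℝ × [−1,1]`.

Proof (elementary, no numerics beyond `e > 2.7182818283`): `(8π²/3)/(4πT)² = 1/(6T²)` and, with
`r = exp u`, `exp(2u) − 2 exp(u) s + 1 ≥ (r − 1)²`; so it suffices that
`r⁴ exp(−(r−1)²/(4T)) ≤ (882/100) T²`.  For `r ≤ 344` this is `344⁴ ≤ (882/100)·(4·10⁴)²`.  For `r > 344`
we use `exp(−y) ≤ 4/(e² y²)` (`y > 0`, from `y/2 ≤ exp(y/2 − 1)`), which gives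
`r⁴ exp(−(r−1)²/(4T)) ≤ 64 T² r⁴/(e² (r−1)⁴)`, and `64 (344/343)⁴ ≤ (882/100)·7.389 ≤ (882/100) e²`.
-/

noncomputable section

-- the registered namespace `Summit.SmoothPoincare4.SmoothPoincare4.Theorems…` repeats a component
set_option linter.dupNamespace false

namespace Summit.SmoothPoincare4.SmoothPoincare4.Theorems.CylinderEntropySliceIsolation

/-- The tangent-line bound `e² y²/4 ≤ exp y` for `y ≥ 0` (equality at `y = 2`), i.e.
`exp(−y) ≤ 4/(e² y²)`. [folklore] -/
theorem certLarge_exp_two_mul_sq_le (y : ℝ) (hy : 0 ≤ y) :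
    Real.exp 2 * y ^ 2 / 4 ≤ Real.exp y := by
  have h1 : y / 2 ≤ Real.exp (y / 2 - 1) := by linarith [Real.add_one_le_exp (y / 2 - 1)]
  have h2 : (y / 2) ^ 2 ≤ Real.exp (y / 2 - 1) ^ 2 := pow_le_pow_left₀ (by linarith) h1 2
  have h3 : Real.exp (y / 2 - 1) ^ 2 * Real.exp 2 = Real.exp y := by
    rw [← Real.exp_nat_mul, ← Real.exp_add]
    norm_num
    ring_nf
  nlinarith [h2, Real.exp_pos 2]

/-- The one-variable heart of the large-scale certificate: for `T ≥ 4·10⁴` and `r ≥ 0`,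
`r⁴ exp(−(r−1)²/(4T)) ≤ (882/100) T²`. [folklore] -/
theorem certLarge_key (T r : ℝ) (hT : 40000 ≤ T) (hr : 0 ≤ r) :
    r ^ 4 * Real.exp (-(r - 1) ^ 2 / (4 * T)) ≤ 882 / 100 * T ^ 2 := by
  have hT0 : 0 < T := by linarith
  have hT2 : (40000 : ℝ) ^ 2 ≤ T ^ 2 := pow_le_pow_left₀ (by norm_num) hT 2
  rcases le_or_gt r 344 with hle | hlt
  · -- small `r`: the Gaussian factor is at most `1`
    have h1 : Real.exp (-(r - 1) ^ 2 / (4 * T)) ≤ 1 := by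
      rw [Real.exp_le_one_iff]
      exact div_nonpos_of_nonpos_of_nonneg (neg_nonpos.2 (sq_nonneg _)) (by positivity)
    have h2 : r ^ 4 ≤ (344 : ℝ) ^ 4 := pow_le_pow_left₀ hr hle 4
    calc r ^ 4 * Real.exp (-(r - 1) ^ 2 / (4 * T)) ≤ (344 : ℝ) ^ 4 * 1 :=
          mul_le_mul h2 h1 (Real.exp_pos _).le (by positivity)
      _ ≤ 882 / 100 * T ^ 2 := by nlinarith [hT2]
  · -- large `r`: `exp(−y) ≤ 4/(e² y²)` with `y = (r−1)²/(4T)`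
    set y : ℝ := (r - 1) ^ 2 / (4 * T) with hy
    have hy0 : 0 ≤ y := by positivity
    have hexp : Real.exp 2 * y ^ 2 / 4 ≤ Real.exp y := certLarge_exp_two_mul_sq_le y hy0
    have he : (27182818283 / 10000000000 : ℝ) < Real.exp 1 := by
      have := Real.exp_one_gt_d9
      norm_num at this ⊢
      exact this
    have he2 : (7389 / 1000 : ℝ) ≤ Real.exp 2 := by
      have h12 : Real.exp 2 = Real.exp 1 * Real.exp 1 := by
        rw [← Real.exp_add]
        norm_num
      rw [h12]
      nlinarith [he, Real.exp_pos 1]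
    have hneg : -(r - 1) ^ 2 / (4 * T) = -y := by rw [hy]; ring
    rw [hneg, Real.exp_neg, mul_inv_le_iff₀ (Real.exp_pos y)]
    have hy2 : Real.exp 2 * y ^ 2 / 4 * (64 * T ^ 2) = Real.exp 2 * (r - 1) ^ 4 := by
      rw [hy]
      field_simp
      ring
    -- the polynomial comparison `64 r⁴ ≤ (882/100)·(7389/1000)·(r−1)⁴` for `r ≥ 344`
    have hcmp : (343 * r) ^ 4 ≤ (344 * (r - 1)) ^ 4 :=
      pow_le_pow_left₀ (by positivity) (by linarith) 4
    have hpoly : 64 * r ^ 4 ≤ 882 / 100 * (7389 / 1000) * (r - 1) ^ 4 := by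
      rw [mul_pow, mul_pow] at hcmp
      norm_num at hcmp
      nlinarith [hcmp, pow_nonneg (by linarith : (0 : ℝ) ≤ r - 1) 4]
    have hr4 : 0 ≤ (r - 1) ^ 4 := pow_nonneg (by linarith) 4
    calc r ^ 4 ≤ 882 / 100 * (Real.exp 2 * (r - 1) ^ 4) / 64 := by
          nlinarith [mul_le_mul_of_nonneg_right he2 hr4]
      _ = 882 / 100 * T ^ 2 * (Real.exp 2 * y ^ 2 / 4) := by
          rw [← hy2]; ring
      _ ≤ 882 / 100 * T ^ 2 * Real.exp y := by gcongr

/-- **Large-scale certificate** (`T ≥ 4·10⁴`, area atom alone): the Jacobian-weighted pulled-back Euclidean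
Gaussian kernel times `V = 8π²/3` is at most `147/100` on `ℝ × [−1,1]`.  Registered stub `stub_certLarge` of
the line `conformal-kernel-domination`. [folklore] -/
theorem stub_certLarge :
    ∀ T : ℝ, 40000 ≤ T → ∀ u s : ℝ, -1 ≤ s → s ≤ 1 →
      (8 * Real.pi ^ 2 / 3) * ((4 * Real.pi * T) ^ 2)⁻¹ * Real.exp (4 * u) *
          Real.exp (-(Real.exp (2 * u) - 2 * Real.exp u * s + 1) / (4 * T)) ≤ 147 / 100 := by
  intro T hT u s _ hs2
  have hT0 : 0 < T := by linarith
  have hpre : (8 * Real.pi ^ 2 / 3) * ((4 * Real.pi * T) ^ 2)⁻¹ = 1 / (6 * T ^ 2) := by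
    have hπ : Real.pi ≠ 0 := Real.pi_ne_zero
    field_simp
    ring
  have hr0 : 0 < Real.exp u := Real.exp_pos u
  have h4 : Real.exp (4 * u) = Real.exp u ^ 4 := by
    rw [← Real.exp_nat_mul]; norm_num
  have h2 : Real.exp (2 * u) = Real.exp u ^ 2 := by
    rw [← Real.exp_nat_mul]; norm_num
  have hE : Real.exp (-(Real.exp (2 * u) - 2 * Real.exp u * s + 1) / (4 * T)) ≤
      Real.exp (-(Real.exp u - 1) ^ 2 / (4 * T)) := by
    rw [h2]
    refine Real.exp_le_exp.2 (div_le_div_of_nonneg_right ?_ (by positivity))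
    nlinarith [mul_nonneg hr0.le (sub_nonneg.2 hs2)]
  have hkey := certLarge_key T (Real.exp u) hT hr0.le
  rw [hpre, h4]
  calc 1 / (6 * T ^ 2) * Real.exp u ^ 4 *
        Real.exp (-(Real.exp (2 * u) - 2 * Real.exp u * s + 1) / (4 * T))
        ≤ 1 / (6 * T ^ 2) * Real.exp u ^ 4 * Real.exp (-(Real.exp u - 1) ^ 2 / (4 * T)) := by
        gcongr
    _ = 1 / (6 * T ^ 2) * (Real.exp u ^ 4 * Real.exp (-(Real.exp u - 1) ^ 2 / (4 * T))) := by ring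
    _ ≤ 1 / (6 * T ^ 2) * (882 / 100 * T ^ 2) := by gcongr
    _ = 147 / 100 := by
        field_simp
        ring

end Summit.SmoothPoincare4.SmoothPoincare4.Theorems.CylinderEntropySliceIsolation

end
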